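import Mathlib
import HarnessLib

/-!
# [OURS · LADDER-RESOLUTION L1 · slot W5.1 · kill test K5.1b continuation] The projection homotopies
# behind `ca(R_𝔪) = (x², y)` (characteristic 3) and `ca(R_𝔪) = (x², xy)` (characteristic 2) for the
# cusp cylinder `R = k[x,y,z]_{(x,y,z)}/(y² − x³)`

Supports the host item `Globalisation` stmt-ResolutionOfSingularities-16486 (route `HomologicalConductor`)
through OUR statement `CaLocalAtClosedPoints` (`Theorems/HomologicalConductorGlobalisationK51ClosedPointLocality`);
nothing here is a statement of the manuscript under adjudication in cell res-hironaka and nothing is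
attributed to its author. Report: cell res-hironaka, `L/res-L1-k51/KILL-TEST-K5.1-k51.md` §10
(Theorems C3 and C2).

## The mathematics (prose; only the two block identities below are kernel-checked)

Let `S′ = k[z]_{(z)}`, `R = S′[x,y]_{(x,y,z)}/(y² − x³)`. For an `R`-regular element `c` of the
cohomology annihilator, every maximal Cohen–Macaulay `R`-module `M` is a direct summand of
`Ω_R(M/cM)` ([IyengarTakahashi2014, Rem. 2.12]; tree
`Literature.RingTheory.CohomologyAnnihilator.exists_retract_isSyzygy_quotSMulTop`), so
`ca(R) = ⋂_N annSt(Ω_R N)` over the maximal Cohen–Macaulay `R/cR`-modules `N`. These are free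
`S′`-modules with commuting matrices `X, Y` (`x ↦ X`, `y ↦ Y`, `Y² = X³`), and `Ω_R N` is presented by the
Shamash matrix factorisation `Φ = [[x − X, y + Y], [−(y − Y), −(x² + xX + X²)]]`,
`Ψ = [[−(x² + xX + X²), −(y + Y)], [y − Y, x − X]]` of `y² − x³` (blocks over `S′[x,y]`); an element `r`
acts stably trivially on `Ω_R N` iff `r·1 = Φ D₀ + D₁ Ψ` for some block matrices `D₀, D₁`.

* Characteristic 3 (`c = y = 2·∂f/∂y`, `Y = 0`, `X³ = 0`): with `π` the projection of `N` onto a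
  complement of the saturated submodule `ker X² ⊇ XN` one has `πX = 0` and `X²π = X²`, and
  `cusp_projection_homotopy` exhibits `x²·1 = Φ D₀ + D₁ Ψ`. Hence `x² ∈ ca(R)` in characteristic 3,
  so `ca(R) = (x², y)R` there as in every characteristic `≠ 2` (upper bound: the curves `t = z^m`).
* Characteristic 2 (`c = x² = ∂f/∂x`, `X² = Y² = 0`): with `N = T ⊕ ker Y`, `π` the projection onto
  `T`, `X = [[X₁, 0], [X₂, X₃]]`, `π₁` the projection of `T` onto a complement of `ker X₁ ⊇ X₁T`, and
  `c₀ = [[0, 0], [X₂π₁, 0]]`, one has `Yπ + πY = Y`, `Yc₀ = c₀Y = 0`, `Xc₀ + c₀X = XπX`, and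
  `cusp_char2_twoProjection_homotopy` exhibits `xy·1 = Φ D₀ + D₁ Ψ`. Hence `xy ∈ ca(R)` in
  characteristic 2 and `ca(R) = (x², xy)R` (upper bound: the curves `t = z^m` and the torus action).

In both characteristics the closed-point value of `ca` is extended from the curve, which is what
`CaLocalAtClosedPoints` asks on a cylinder (report §10.1 (S4)).

The identities are stated over an arbitrary algebra `B` over a commutative ring `A` (in the application
`A = S′[x,y]`, `B = M_r(A)`, `x, y` scalars), with exactly the relations used.

## References
* S. B. Iyengar, R. Takahashi, *Annihilation of cohomology and strong generation of module categories*,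
  IMRN 2016 (arXiv:1404.1476), Rem. 2.12, Lemma 2.14. [IyengarTakahashi2014]
-/

set_option autoImplicit false

namespace Summit.ResolutionOfSingularities.ResolutionOfSingularities.Theorems.K51ProjectionHomotopy

open Matrix

variable {A B : Type*} [CommRing A] [Ring B] [Algebra A B]

/-- **The Shamash factorisation is a matrix factorisation.** For commuting `X, Y` with `Y² = X³`
(an `R`-module structure on a free `S′`-module, `x ↦ X`, `y ↦ Y`), the block matrices
`Φ = [[x − X, y + Y], [−(y − Y), −(x² + xX + X²)]]` and `Ψ = [[−(x² + xX + X²), −(y + Y)], [y − Y, x − X]]`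
satisfy `Φ Ψ = (y² − x³)·1`. [OURS · L1 W5.1; report §10.2] -/
theorem shamash_isMatrixFactorization (x y : A) (X Y : B) (hXY : X * Y = Y * X)
    (hrel : Y * Y = X * (X * X)) :
    !![x • (1 : B) - X, y • (1 : B) + Y; -(y • (1 : B) - Y), -(x ^ 2 • (1 : B) + x • X + X * X)] *
      !![-(x ^ 2 • (1 : B) + x • X + X * X), -(y • (1 : B) + Y); y • (1 : B) - Y, x • (1 : B) - X] =
      !![(y ^ 2 - x ^ 3) • (1 : B), 0; 0, (y ^ 2 - x ^ 3) • (1 : B)] := by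
  have hXYb : ∀ b : B, X * (Y * b) = Y * (X * b) := fun b => by rw [← mul_assoc, hXY, mul_assoc]
  refine Matrix.ext fun i j => ?_
  fin_cases i <;> fin_cases j <;>
    simp only [Matrix.mul_apply, Fin.sum_univ_two, Matrix.of_apply, Matrix.cons_val', Matrix.cons_val_zero,
      Matrix.cons_val_one, Matrix.empty_val', Matrix.cons_val_fin_one, Fin.zero_eta, Fin.mk_one,
      Fin.isValue] <;>
    simp only [smul_mul_assoc, mul_smul_comm, smul_smul, mul_add, add_mul, mul_one, one_mul, mul_neg, neg_mul,
      neg_neg, neg_add, smul_add, smul_neg, mul_assoc, hrel, hXY, hXYb, sub_eq_add_neg] <;>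
    module

/-- **Theorem C3, kernel form (the projection homotopy).** Let `x, y` be scalars and `X, π` elements of
an algebra with `πX = 0` and `X²π = X²` (in the application: `π` is the projection of a `k[z]_{(z)}`-lattice
`N` onto a complement of `ker X² ⊇ XN`, which exists because `ker X²` is saturated). Then with
`Q = x² + xX + X²`, `α = x(1 − π) + (X − Xπ)`, `δ = −π`,
`Φ·diag(α, δ) + diag(δ, α)·Ψ = x²·1` for the Shamash factorisation `(Φ, Ψ)` of `y² − x³` with `Y = 0`:
`x²` acts stably trivially on `Ω_R N`. [OURS · L1 W5.1; report §10.3] -/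
theorem cusp_projection_homotopy (x y : A) (X π : B) (hπX : π * X = 0)
    (hX2π : X * (X * π) = X * X) :
    !![x • (1 : B) - X, y • (1 : B); -(y • (1 : B)), -(x ^ 2 • (1 : B) + x • X + X * X)] *
        !![x • (1 - π) + (X - X * π), 0; 0, -π] +
      !![-π, 0; 0, x • (1 - π) + (X - X * π)] *
        !![-(x ^ 2 • (1 : B) + x • X + X * X), -(y • (1 : B)); y • (1 : B), x • (1 : B) - X] =
      !![x ^ 2 • (1 : B), 0; 0, x ^ 2 • (1 : B)] := by
  have hπXb : ∀ b : B, π * (X * b) = 0 := fun b => by rw [← mul_assoc, hπX, zero_mul]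
  refine Matrix.ext fun i j => ?_
  fin_cases i <;> fin_cases j <;>
    simp only [Matrix.add_apply, Matrix.mul_apply, Fin.sum_univ_two, Matrix.of_apply, Matrix.cons_val',
      Matrix.cons_val_zero, Matrix.cons_val_one, Matrix.empty_val', Matrix.cons_val_fin_one, Fin.zero_eta,
      Fin.mk_one, Fin.isValue] <;>
    simp only [smul_mul_assoc, mul_smul_comm, smul_smul, mul_add, add_mul, mul_one, one_mul, mul_neg, neg_mul,
      neg_neg, neg_add, smul_add, smul_neg, mul_assoc, hπX, hπXb, hX2π, sub_eq_add_neg, neg_zero, add_zero,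
      zero_add, mul_zero, zero_mul, smul_zero] <;>
    module

/-- **Theorem C2, kernel form (the two-projection homotopy, characteristic 2).** Let the scalars have
characteristic `2`, `x, y` scalars, and `X, Y, π, c` elements of an algebra with `XY = YX`, `X² = 0`,
`πY = Y + Yπ` (i.e. `Yπ + πY = Y`), `cY = Yc` (i.e. `Yc + cY = 0`), `cX = XπX + Xc` (i.e. `Xc + cX = XπX`)
— in the application: `N = T ⊕ ker Y` a `k[z]_{(z)}`-lattice with `X² = Y² = 0`, `π` the projection onto
`T`, `π₁` the projection of `T` onto a complement of `ker X|_T`, `c = [[0,0],[X₂π₁,0]]`. Then with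
`Q = x² + xX`, `b = c + Xπ + πX`, `β = x(1+π) + b`, `β′ = x(1+π) + c`, `γ = xπ + c`, `γ′ = xπ + b`:
`Φ·[[0, β],[γ, 0]] + [[0, β′],[γ′, 0]]·Ψ = xy·1` for the Shamash factorisation
`Φ = [[x + X, y + Y],[y + Y, Q]]`, `Ψ = [[Q, y + Y],[y + Y, x + X]]` of `y² + x³`: `xy` acts stably trivially
on `Ω_R N`. [OURS · L1 W5.1; report §10.4] -/
theorem cusp_char2_twoProjection_homotopy [CharP A 2] (x y : A) (X Y π c : B)
    (hXY : X * Y = Y * X) (hX2 : X * X = 0) (hπY : π * Y = Y + Y * π) (hcY : c * Y = Y * c)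
    (hcX : c * X = X * (π * X) + X * c) :
    !![x • (1 : B) + X, y • (1 : B) + Y; y • (1 : B) + Y, x ^ 2 • (1 : B) + x • X] *
        !![0, x • (1 + π) + (c + X * π + π * X); x • π + c, 0] +
      !![0, x • (1 + π) + c; x • π + (c + X * π + π * X), 0] *
        !![x ^ 2 • (1 : B) + x • X, y • (1 : B) + Y; y • (1 : B) + Y, x • (1 : B) + X] =
      !![(x * y) • (1 : B), 0; 0, (x * y) • (1 : B)] := by
  have hXYb : ∀ b : B, X * (Y * b) = Y * (X * b) := fun b => by rw [← mul_assoc, hXY, mul_assoc]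
  have hX2b : ∀ b : B, X * (X * b) = 0 := fun b => by rw [← mul_assoc, hX2, zero_mul]
  have hπYb : ∀ b : B, π * (Y * b) = Y * b + Y * (π * b) := fun b => by
    rw [← mul_assoc, hπY, add_mul, mul_assoc]
  refine Matrix.ext fun i j => ?_
  fin_cases i <;> fin_cases j <;>
    simp only [Matrix.add_apply, Matrix.mul_apply, Fin.sum_univ_two, Matrix.of_apply, Matrix.cons_val',
      Matrix.cons_val_zero, Matrix.cons_val_one, Matrix.empty_val', Matrix.cons_val_fin_one, Fin.zero_eta,
      Fin.mk_one, Fin.isValue] <;>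
    simp only [smul_mul_assoc, mul_smul_comm, smul_smul, mul_add, add_mul, mul_one, one_mul, smul_add,
      mul_assoc, hXY, hXYb, hX2, hX2b, hπY, hπYb, hcY, hcX, add_zero, zero_add, mul_zero, zero_mul,
      smul_zero] <;>
    match_scalars <;>
    (ring_nf <;> simp [CharTwo.two_eq_zero])

end Summit.ResolutionOfSingularities.ResolutionOfSingularities.Theorems.K51ProjectionHomotopy
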